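import Mathlib
import Summits.NavierStokesRegularity.Statement
import Summits.NavierStokesRegularity.NavierStokesRegularity.Theorems.BlowupAssembly
import Literature.Analysis.FluidPDE.ClassicalSolution
import Literature.Analysis.FluidPDE.LerayHopf
import Literature.Analysis.FluidPDE.NSWave0
import Literature.Analysis.FluidPDE.NSLerayHopf
import Literature.Analysis.FluidPDE.AxisymmetricEuler
import Literature.Analysis.FluidPDE.SelfSimilarLiouville

/-!
# NavierStokesRegularity — route `CertifiedBlowup`, kill edge (rank 6)

Settles `stmt-NavierStokesRegularity-0729` (positive, formal glue): the open wall
`Literature.Analysis.FluidPDE.AxisymmetricSwirlRegularity` (global classical bounded-energy solutions from rapidly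
decaying axisymmetric data; KNSS 2009 §5) together with Clay-class uniqueness `X5b`
(`stmt-NavierStokesRegularity-0153`) refutes `X5a_axi` (`stmt-NavierStokesRegularity-0727`,
finite-time blow-up of a maximal smooth Leray–Hopf solution from a rapidly decaying axisymmetric
datum). Same eight lines as `Literature.NS.blowup_assembly` with Clay (A) replaced by the axisymmetric
wall. Both hypotheses are open; nothing analytic is proved here.
-/

open Set

namespace Literature.NS

/-- Settles stmt-NavierStokesRegularity-0729: `AxisymmetricSwirlRegularity → X5b → ¬ X5a_axi`.
From the `X5a_axi` witness `(ν, T, u, p)` the wall gives a global classical bounded-energy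
`(U, P)` from `u 0`; `X5b` glues `U = u` on `[0, T)`; restricting `U` to `[0, T + 1)` is a smooth
extension past `T`, contradicting maximality (Beale–Kato–Majda 1984 §1). [folklore] -/
theorem certifiedBlowup_kill_edge :
    Literature.Analysis.FluidPDE.AxisymmetricSwirlRegularity → (∀ ν : ℝ, 0 < ν → ∀ (u₀ : EuclideanSpace ℝ (Fin 3) → EuclideanSpace ℝ (Fin 3)), Literature.Analysis.FluidPDE.HasRapidSpatialDecay u₀ → ∀ (u v : ℝ → EuclideanSpace ℝ (Fin 3) → EuclideanSpace ℝ (Fin 3)) (p q : ℝ → EuclideanSpace ℝ (Fin 3) → ℝ) (T : ℝ), 0 < T → Literature.Analysis.FluidPDE.IsSmoothOnHalfSpace u → Literature.Analysis.FluidPDE.IsSmoothOnHalfSpace p → Literature.Analysis.FluidPDE.IsNavierStokesSolution ν 0 u₀ u p → Literature.Analysis.FluidPDE.HasBoundedEnergy u → Literature.Analysis.FluidPDE.IsClassicalNSSolutionOn (Set.Ico 0 T) ν 0 v q → Literature.Analysis.FluidPDE.IsLerayHopfOn T ν 0 u₀ v → v 0 = u₀ → ∀ t ∈ Set.Ico 0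 T, u t = v t) → ¬ (∃ ν : ℝ, 0 < ν ∧ ∃ T : ℝ, 0 < T ∧ ∃ (u : ℝ → EuclideanSpace ℝ (Fin 3) → EuclideanSpace ℝ (Fin 3)) (p : ℝ → EuclideanSpace ℝ (Fin 3) → ℝ), Literature.Analysis.FluidPDE.IsMaximalSmoothSolution ν 0 u p T ∧ Literature.Analysis.FluidPDE.IsLerayHopfOn T ν 0 (u 0) u ∧ Literature.Analysis.FluidPDE.HasRapidSpatialDecay (u 0) ∧ Literature.Analysis.FluidPDE.IsAxisymmetric (u 0)) := by
  rintro hAX hX5b ⟨ν, hν, T, hT, u, p, ⟨hcl, hmax⟩, hLH, hdec, haxi⟩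
  have h0 : (0 : ℝ) ∈ Set.Ico 0 T := ⟨le_rfl, hT⟩
  obtain ⟨u', p', hcl', hinit, hbe⟩ :=
    hAX ν hν (u 0) (hcl.contDiff_velocity h0) (hcl.divFree 0 h0) hdec haxi
  obtain ⟨hns, hu', hp'⟩ := Literature.Analysis.FluidPDE.isNavierStokesSolution_and_smooth_iff.2 ⟨hcl', hinit⟩
  have heq : ∀ t ∈ Set.Ico 0 T, u' t = u t :=
    hX5b ν hν (u 0) hdec u' u p' p T hT hu' hp' hns hbe hcl hLH rfl
  refine hmax ⟨T + 1, by linarith, u', p', ?_, heq⟩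
  exact hcl'.mono (fun t ht => ht.1) (uniqueDiffOn_Ico 0 (T + 1))

end Literature.NS
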